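import Summits.QuantumFields.YangMills.Theorems.FluctuationComparisonRegPrIntLS2BetaGapFlatOfStabiliserLift
import Summits.QuantumFields.YangMills.Theorems.UnitScaleTiltMinimiserStabilityRegPrOfB8Thm2AtT3Members
import HarnessLib

/-!
# S2β · POS∘ AT PRINT'S REGULAR MINIMISER AT EVERY BLOCK SIZE `L > 1` FROM THE ONE NAMED FACT `B8Thm2AtT3Members` — the `hPos` letter of ✓p811291's all-`L` door
# (crux `FluctuationComparisonRegPrIntL`, stmt-QuantumFields-20520; FILE C of px13 g22's pen «the S2β organ road ⟸ `B8Thm2AtT3Members`»)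

Cell `ym3-torus` (YM ladder rung R3 = continuum `SU(2)` Yang–Mills on T³ — a RUNG, NOT d = 4, NOT infinite volume, NOT a mass gap, NOT Clay); width seat `ym3-torus-px17`
(gen 17); `--supports stmt-QuantumFields-20520 --as helper`, count-neutral, DEFINITION-FREE, default heartbeats; registry v11.4 3732b7df UNTOUCHED.

WHAT.  The `_five` chain ✓`orbitGrowth_of_isCritR2_five` → ✓px8 g19 `growthOn_nhds_at_isCritR2_of_lift_five` → ✓px17 g16 `growthOn_nhds_at_isCritR2_of_lift_five'` →
✓`posCollar_at_isCritR2_of_lift_five'` uses `L ≥ 5` ONLY through the [Balaban1985RegularSpaces] Thm-2 socket ✓`hThm2S_body_of_five_le`.  Here the same proofs are re-keyed: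
* §1 ★★★ `orbitGrowth_of_isCritR2_of_thm2S (hL) (hB₁ hc₁) (hThm2S)` — ✓`orbitGrowth_of_isCritR2_five`'s text at the socket's `L` (✓`orbitGrowth_of_regular_of_thm2S` + Fermat ✓`Prop7CritEL`).
* §2 ★★★ `growthOn_nhds_at_isCritR2_of_lift_of_orbitGrowth (hOG)` ∕ `…_of_orbitGrowth' (hL) (hOG)` ∕ ★★★ `posCollar_at_isCritR2_of_lift_of_orbitGrowth' (hL) (hOG)` — ✓px8 g19's and
  ✓px17 g16's proofs VERBATIM with the orbit-growth letter `hOG` (= ✓`orbitGrowth_of_isCritR2_five`'s conclusion at `L`) in place of the `_five` call.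
* §3 ★★★ `posCollar_at_isCritR2_of_lift_of_b8Thm2AtT3Members (hX : B8Thm2AtT3Members) (L) (hL : 1 < L)` — THE `hPos` LETTER OF ✓p811291 `gapFlatOrgan_of_lettersAtThree` ∕
  `gapFlatOrganAt_of_letters` AT EVERY `L > 1` (in particular at `L = 3`) from the ONE named Literature fact (✓`hThm2S_of_b8Thm2AtT3Members`); at `L ≥ 5` it is
  ✓`posCollar_at_isCritR2_of_lift_five'` outright.
With px13 g22's FILE B (the lifting, Prop-7 and Thm-1-pair letters from `hX`) the assembly `gapFlatOrgan_of_b8Thm2AtT3Members (hX) : ∀ L, ⟨GAP♭∘-at-L⟩` is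
`gapFlatOrgan_of_lettersAtThree (posCollar_at_isCritR2_of_lift_of_b8Thm2AtT3Members hX 3 (by norm_num)) … … …` — typed in whichever file lands last.

HONEST SCOPE (CREDIT NOTHING): re-keyed copies of landed proofs; `B8Thm2AtT3Members` is OPEN exactly at `L = 3` (EMBARGO-LITE №58 honoured — no Thm-2 proof attempted); nothing
at `L = 3` is proved unconditionally; GAP♯∘ as registered, DET-REP-B, H4ᶜ∘, LFR♯ᶜ∘, S2β, crux 20520, 19936, 19200 and `YM3TorusSU2` are NOT proved; rung R3 = SU(2) YM₃ on T³ at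
fixed lattice data — NOT d = 4, NOT infinite volume, NOT a mass gap, NOT Clay; the Yang–Mills mass gap is NOT proved.  Sorry-free, axioms standard.

References: T. Bałaban, CMP **102** (1985) 277–309 [Balaban1985Variational] ((2)–(6) p.278, Thm 1 (8)–(10) p.279, (141)–(143) p.299); CMP **99** (1985) 75–102
[Balaban1985RegularSpaces] (Thm 2 p.83); CMP **98** (1985) 17–51 [Balaban1985Averaging] (Prop. 2 (52)–(54) p.26, Prop. 5 (157) p.42); CMP **102** (1985) 255–275
[Balaban1985UV3] ((12)–(13) p.259).
-/

set_option autoImplicit false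

noncomputable section

namespace Summit.QuantumFields.YangMills.Theorems.FluctuationComparisonRegPrIntLS2BetaPosCollarOfB8Thm2AtT3Members

open Set Filter Topology Function
open scoped Matrix.Norms.L2Operator
open Literature.MathematicalPhysics.QuantumFieldTheory.Balaban1983to89
open Literature.MathematicalPhysics.QuantumFieldTheory.Balaban1983to89.T3ContinuumYM3Torus
open Literature.MathematicalPhysics.QuantumFieldTheory.Balaban1983to89.T3UnitLawDensityEML (ℰp)
open Literature.MathematicalPhysics.QuantumFieldTheory.Balaban1983to89.T3UnitScaleTilt
open Literature.MathematicalPhysics.QuantumFieldTheory.Balaban1983to89.T3TiltDescent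
open Literature.MathematicalPhysics.QuantumFieldTheory.Balaban1983to89.T3ConstrainedMinimiser (fibre)
open Literature.MathematicalPhysics.QuantumFieldTheory.Balaban1983to89.T3PrintedRegularMinimiser
open Literature.MathematicalPhysics.QuantumFieldTheory.Balaban1983to89.T3PrintedRegularOrbits (descTransf descendTo_gaugeAct liftTransfTo descTransf_liftTransfTo)
open Literature.MathematicalPhysics.QuantumFieldTheory.Balaban1983to89.T3Thm1CarrierNative (IsCritR2 isCritR2_of_isMinOn)
open Literature.MathematicalPhysics.QuantumFieldTheory.Balaban1983to89.T3B8Thm2AtMembers (B8Thm2AtT3Members)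
open Literature.MathematicalPhysics.QuantumFieldTheory.Balaban1983to89.T4Continuum
open scoped Literature.MathematicalPhysics.QuantumFieldTheory.Balaban1983to89.T3OrbitAverage
open T3SectALandauChart (eta)
open B8Thm2SetupTorus (Thm2SetupSUAt)
open Summit.QuantumFields.YangMills.Theorems.FluctuationComparisonRegPrIntLS2BetaResidualGauge
open Summit.QuantumFields.YangMills.Theorems.FluctuationComparisonRegPrIntLS2BetaPosCollarOfGrowthRow (iInf_orbitDistSq_gaugeAct_left iInf_orbitDistSq_le_sum_one)
open Summit.QuantumFields.YangMills.Theorems.FluctuationComparisonRegPrIntLS2BetaPosCollarCoverOfTubeChart (mem_fibre_of_mem_closure_of_continuousAt)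
open Summit.QuantumFields.YangMills.Theorems.FluctuationComparisonRegPrIntLS2BetaPosCollarOfLocalGrowth
open Summit.QuantumFields.YangMills.Theorems.FluctuationComparisonRegPrIntLS2BetaOrbitDistComparison (sum_dist1_sq_gaugeAct sum_dist1_sq_comm sqrt_sum_dist1_sq_triangle)
open Summit.QuantumFields.YangMills.Theorems.FluctuationComparisonRegPrIntLS2BetaOrbitGrowthOfRegular (orbitGrowth_of_regular_of_thm2S)
open Summit.QuantumFields.YangMills.Theorems.Prop7CritEL (isOpen_regPr deriv_comp_eq_zero_of_isCritR2 continuousAt_of_differentiableAt_bonds)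
open Summit.QuantumFields.YangMills.Theorems.FluctuationComparisonRegPrIntLS2BetaSignedCombLipschitz (dist1_mul_inv_eq_norm_sub)
open Summit.QuantumFields.YangMills.Theorems.FluctuationComparisonRegPrIntLS2BetaNearSymmetryRigidity
open Summit.QuantumFields.YangMills.Theorems.FluctuationComparisonRegPrIntLS2BetaNearStabiliserRigidity (exists_near_stabiliser)
open Summit.QuantumFields.YangMills.Theorems.FluctuationComparisonRegPrIntLS2BetaResidualNearOfStabiliserLift (exists_residual_near_of_near_orbit_of_lift)
open Summit.QuantumFields.YangMills.Theorems.FluctuationComparisonRegPrIntLS2BetaPosCollarLocalRows (eventually_continuousAt_descendTo_of_mem_regFibrePr)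
open Summit.QuantumFields.YangMills.Theorems.FluctuationComparisonRegPrIntLS2BetaDescentLipschitz (exists_ePi exists_threshold_supLipschitz)
open Summit.QuantumFields.YangMills.Theorems.MinimiserStabilityRegPrOfB8Thm2AtT3Members (hThm2S_of_b8Thm2AtT3Members)

/-! ## §1 Orbit growth at a minimiser over the regular fibre, for the Thm-2 socket's block size -/

/-- ★★★ **ORBIT-`dist1²` GROWTH AT A MINIMISER OVER THE REGULAR FIBRE, FOR THE SOCKET's `L`** — ✓`orbitGrowth_of_isCritR2_five`'s text with `L ≥ 5` replaced by the
[Balaban1985RegularSpaces] Thm-2 socket `hThm2S` at `L` (✓`orbitGrowth_of_regular_of_thm2S`; the E–L binder discharged by Fermat, ✓`deriv_comp_eq_zero_of_isCritR2`).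
[cite: Balaban1985Variational, (141)-(143) p.299, (5)-(6) p.278; Balaban1985RegularSpaces, Thm 2 p.83] -/
theorem orbitGrowth_of_isCritR2_of_thm2S {L : ℕ} (hL : 1 < L) {B₁ c₁ : ℝ} (hB₁ : 0 < B₁) (hc₁ : 0 < c₁)
    (hThm2S : ∀ (F : T3Family), F.L = L → ∀ (n K : ℕ), n < K →
      ∃ (β₀ B₂ : ℝ) (len : B7Prop1Explicit.Site (F.P K).d → ℝ), Thm2SetupSUAt (F.P K) 2 (K - n) (eta F n K) β₀ B₁ B₂ c₁ len (fun _ => True)) :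
    ∃ e₈ c : ℝ, 0 < e₈ ∧ 0 < c ∧
      ∀ (F : T3Family), F.L = L → ∀ (n K : ℕ) (hnK : n < K) (e : ℝ) (V : GaugeField (F.P n) 0 (Matrix.specialUnitaryGroup (Fin 2) ℂ))
        (W : GaugeField (F.P K) 0 (Matrix.specialUnitaryGroup (Fin 2) ℂ)),
        0 < e → e ≤ e₈ → W ∈ regFibrePr F n K hnK.le e V → IsCritR2 F n K hnK.le V W →
        ∀ W' : GaugeField (F.P K) 0 (Matrix.specialUnitaryGroup (Fin 2) ℂ), W' ∈ regFibrePr F n K hnK.le e V →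
          ∃ u : GaugeTransf (F.P K) 0 (Matrix.specialUnitaryGroup (Fin 2) ℂ),
            c * (((F.L : ℝ) ^ (K - n)) ^ 2)⁻¹ * (∑ ℓ : PBond (F.P K) 0, dist1 (W' ℓ * ((GaugeField.gaugeAct u W) ℓ)⁻¹) ^ 2)
              ≤ wilsonAction4 W' - wilsonAction4 W := by
  obtain ⟨e₈, c, he₈, hc, H⟩ := orbitGrowth_of_regular_of_thm2S hL hB₁ hc₁ hThm2S
  refine ⟨e₈, c, he₈, hc, fun F hF n K hnK e V W he heε hW hcrit W' hW' => H F hF n K hnK e V W he heε hW ?_ W' hW'⟩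
  intro γ hγ0 hγfib hγd
  exact deriv_comp_eq_zero_of_isCritR2 hcrit γ hγ0 hγfib (continuousAt_of_differentiableAt_bonds γ hγd)


/-! ## §2 ✓px8 g19's and ✓px17 g16's POS∘ chain re-keyed on the orbit-growth letter -/

/-- ★★★ **INTRINSIC LOCAL GROWTH AT PRINT'S REGULAR MINIMISER OVER A DATUM WHOSE SYMMETRIES LIFT — keyed on the orbit-growth letter `hOG`** (= ✓`orbitGrowth_of_isCritR2_five`'s
conclusion at `L`); proof = ✓px8 g19 `growthOn_nhds_at_isCritR2_of_lift_five`'s VERBATIM after the first `obtain`.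
[cite: Balaban1985Variational, (2)-(6) p.278, Thm 1 (8)-(10) p.279, (141)-(143) p.299; Balaban1985Averaging, Prop. 2 (52)-(54) p.26] -/
theorem growthOn_nhds_at_isCritR2_of_lift_of_orbitGrowth {L : ℕ}
    (hOG : ∃ e₈ c : ℝ, 0 < e₈ ∧ 0 < c ∧
        ∀ (F : T3Family), F.L = L → ∀ (n K : ℕ) (hnK : n < K) (e : ℝ) (V : GaugeField (F.P n) 0 (Matrix.specialUnitaryGroup (Fin 2) ℂ))
          (W : GaugeField (F.P K) 0 (Matrix.specialUnitaryGroup (Fin 2) ℂ)),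
          0 < e → e ≤ e₈ → W ∈ regFibrePr F n K hnK.le e V → IsCritR2 F n K hnK.le V W →
          ∀ W' : GaugeField (F.P K) 0 (Matrix.specialUnitaryGroup (Fin 2) ℂ), W' ∈ regFibrePr F n K hnK.le e V →
            ∃ u : GaugeTransf (F.P K) 0 (Matrix.specialUnitaryGroup (Fin 2) ℂ),
              c * (((F.L : ℝ) ^ (K - n)) ^ 2)⁻¹ * (∑ ℓ : PBond (F.P K) 0, dist1 (W' ℓ * ((GaugeField.gaugeAct u W) ℓ)⁻¹) ^ 2)
                ≤ wilsonAction4 W' - wilsonAction4 W) :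
    ∃ e₈ : ℝ, 0 < e₈ ∧
      ∀ (F : T3Family), F.L = L → ∀ (J K : ℕ) (hJK : J < K) (e γ b₀ p₀ ε₀ : ℝ)
        (V : GaugeField (F.P J) 0 (Matrix.specialUnitaryGroup (Fin 2) ℂ)) (U₀ : GaugeField (F.P K) 0 (Matrix.specialUnitaryGroup (Fin 2) ℂ)),
        0 < e → e ≤ e₈ → U₀ ∈ regFibrePr F J K hJK.le e V → IsCritR2 F J K hJK.le V U₀ →
        wilsonAction4 U₀ = minActionRegPr F J K hJK.le ε₀ V →
        (∀ᶠ W in 𝓝 U₀, ContinuousAt (descendTo F ℰp J K hJK.le) W) →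
        (∀ s : GaugeTransf (F.P J) 0 (Matrix.specialUnitaryGroup (Fin 2) ℂ), GaugeField.gaugeAct s V = V →
            ∃ k : GaugeTransf (F.P K) 0 (Matrix.specialUnitaryGroup (Fin 2) ℂ), GaugeField.gaugeAct k U₀ = U₀ ∧ descTransf F J K hJK.le k = s) →
        ∀ (ρ₀ Kπ : ℝ), 0 < ρ₀ → 0 ≤ Kπ →
        (∀ (B : GaugeField (F.P K) 0 (Matrix.specialUnitaryGroup (Fin 2) ℂ)) (ρ : ℝ), 0 ≤ ρ → ρ ≤ ρ₀ →
          (∀ ℓ : PBond (F.P K) 0, ‖(U₀ ℓ : Matrix (Fin 2) (Fin 2) ℂ) - (B ℓ : Matrix (Fin 2) (Fin 2) ℂ)‖ ≤ ρ) →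
          ∀ b : PBond (F.P J) 0,
            ‖((descendTo F ℰp J K hJK.le U₀ b : Matrix.specialUnitaryGroup (Fin 2) ℂ) : Matrix (Fin 2) (Fin 2) ℂ) -
                ((descendTo F ℰp J K hJK.le B b : Matrix.specialUnitaryGroup (Fin 2) ℂ) : Matrix (Fin 2) (Fin 2) ℂ)‖ ≤ Kπ * ρ) →
        ∃ N ∈ 𝓝 U₀, ∃ c : ℝ, 0 < c ∧
          ∀ U ∈ closure (fibre F ℰp J K hJK.le V ∩ histGood F ℰp (θBal F.L γ b₀ p₀) K J), U ∈ N →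
            c * (⨅ w : {w : Site (F.P K) 0 → Matrix.specialUnitaryGroup (Fin 2) ℂ |
                  ∀ U : GaugeField (F.P K) 0 (Matrix.specialUnitaryGroup (Fin 2) ℂ),
                    descendTo F ℰp J K hJK.le (GaugeField.gaugeAct w U) = descendTo F ℰp J K hJK.le U},
                ∑ ℓ : PBond (F.P K) 0,
                  dist1 (U ℓ * ((GaugeField.gaugeAct (w : Site (F.P K) 0 → Matrix.specialUnitaryGroup (Fin 2) ℂ) U₀) ℓ)⁻¹) ^ 2)
              ≤ wilsonAction4 U - minActionRegPr F J K hJK.le ε₀ V := by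
  obtain ⟨e₈, c, he₈, hc, HG⟩ := hOG
  refine ⟨e₈, he₈, ?_⟩
  intro F hF J K hJK e γ b₀ p₀ ε₀ V U₀ he heε hU₀reg hcrit hmin hcont hlift ρ₀ Kπ hρ₀ hKπ hLip
  -- per-datum constants
  obtain ⟨KV, hKV, HR⟩ := exists_near_stabiliser V
  have hL1 : (1 : ℝ) < (F.L : ℝ) := by have := F.hL.2; exact_mod_cast (by omega : 1 < F.L)
  obtain ⟨cℓ, hcℓ⟩ : ∃ cℓ : ℝ, cℓ = c * (((F.L : ℝ) ^ (K - J)) ^ 2)⁻¹ := ⟨_, rfl⟩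
  have hcℓ0 : 0 < cℓ := by rw [hcℓ]; exact mul_pos hc (inv_pos.mpr (by positivity))
  obtain ⟨M, hM⟩ : ∃ M : ℝ, M = 1 + 2 * Real.sqrt (Fintype.card (PBond (F.P K) 0) : ℝ) *
      (KV * (Real.sqrt (Fintype.card (PBond (F.P J) 0) : ℝ) * Kπ)) := ⟨_, rfl⟩
  have hM0 : 0 < M := by
    have : 0 ≤ 2 * Real.sqrt (Fintype.card (PBond (F.P K) 0) : ℝ) * (KV * (Real.sqrt (Fintype.card (PBond (F.P J) 0) : ℝ) * Kπ)) := by positivity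
    rw [hM]; linarith
  -- the neighbourhood: regular ∩ continuity of the descent ∩ small action increment
  have hU₀fib : U₀ ∈ fibre F ℰp J K hJK.le V := ((mem_regFibrePr_iff F).1 hU₀reg).1
  have hU₀V : descendTo F ℰp J K hJK.le U₀ = V := hU₀fib
  have hreg0 : U₀ ∈ {U : GaugeField (F.P K) 0 (Matrix.specialUnitaryGroup (Fin 2) ℂ) | RegPr F J K e U} := ((mem_regFibrePr_iff F).1 hU₀reg).2
  have hAopen : IsOpen {U : GaugeField (F.P K) 0 (Matrix.specialUnitaryGroup (Fin 2) ℂ) | wilsonAction4 U < wilsonAction4 U₀ + cℓ * ρ₀ ^ 2} :=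
    isOpen_lt (B16Thm1BaseAtRecord11.continuous_wilsonAction4_SU (N := 2) (F.P K) 0) continuous_const
  have hA0 : U₀ ∈ {U : GaugeField (F.P K) 0 (Matrix.specialUnitaryGroup (Fin 2) ℂ) | wilsonAction4 U < wilsonAction4 U₀ + cℓ * ρ₀ ^ 2} := by
    show wilsonAction4 U₀ < wilsonAction4 U₀ + cℓ * ρ₀ ^ 2
    have : 0 < cℓ * ρ₀ ^ 2 := by positivity
    linarith
  have hN : ({U : GaugeField (F.P K) 0 (Matrix.specialUnitaryGroup (Fin 2) ℂ) | RegPr F J K e U} ∩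
      {W | ContinuousAt (descendTo F ℰp J K hJK.le) W} ∩
      {U | wilsonAction4 U < wilsonAction4 U₀ + cℓ * ρ₀ ^ 2}) ∈ 𝓝 U₀ :=
    inter_mem (inter_mem ((isOpen_regPr F J K e).mem_nhds hreg0) hcont) (hAopen.mem_nhds hA0)
  refine ⟨_, hN, cℓ / M ^ 2, div_pos hcℓ0 (by positivity), ?_⟩
  intro U hUcl hUN
  obtain ⟨⟨hUreg', hUcont⟩, hUA⟩ := hUN
  -- a near point of the closed good fibre is a regular competitor
  have hUf : U ∈ fibre F ℰp J K hJK.le V := mem_fibre_of_mem_closure_of_continuousAt F hJK.le (closure_mono inter_subset_left hUcl) hUcont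
  have hUV : descendTo F ℰp J K hJK.le U = V := hUf
  have hUreg : U ∈ regFibrePr F J K hJK.le e V := (mem_regFibrePr_iff F).2 ⟨hUf, hUreg'⟩
  -- pen 3: the fine gauge `u` and the growth row
  obtain ⟨u, hgrow⟩ := HG F hF J K hJK e V U₀ he heε hU₀reg hcrit U hUreg
  obtain ⟨ρsq, hρsq⟩ : ∃ ρsq : ℝ, ρsq = ∑ ℓ : PBond (F.P K) 0, dist1 (U ℓ * ((GaugeField.gaugeAct u U₀) ℓ)⁻¹) ^ 2 := ⟨_, rfl⟩
  have hρsq0 : 0 ≤ ρsq := by rw [hρsq]; exact Finset.sum_nonneg fun ℓ _ => sq_nonneg _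
  obtain ⟨ρ, hρ⟩ : ∃ ρ : ℝ, ρ = Real.sqrt ρsq := ⟨_, rfl⟩
  have hρ0 : 0 ≤ ρ := by rw [hρ]; exact Real.sqrt_nonneg _
  have hρ2 : ρ ^ 2 = ρsq := by rw [hρ]; exact Real.sq_sqrt hρsq0
  have hgrow' : cℓ * ρsq ≤ wilsonAction4 U - wilsonAction4 U₀ := by rw [hcℓ, hρsq]; exact hgrow
  -- `ρ ≤ ρ₀` from the small action increment
  have hρρ₀ : ρ ≤ ρ₀ := by
    have h1 : cℓ * ρsq < cℓ * ρ₀ ^ 2 := by have := hUA.out; linarith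
    have h2 : ρsq < ρ₀ ^ 2 := lt_of_mul_lt_mul_left h1 hcℓ0.le
    have h3 : ρ ^ 2 < ρ₀ ^ 2 := by rw [hρ2]; exact h2
    exact le_of_lt (by nlinarith [hρ0, hρ₀])
  -- §4: a residual `w` with `d(w•U, U₀) ≤ M·ρ`
  obtain ⟨w, hwres, hdist⟩ := exists_residual_near_of_near_orbit_of_lift F hJK.le V U₀ U hU₀V hUV hKV HR hlift hKπ hLip
    (u : Site (F.P K) 0 → Matrix.specialUnitaryGroup (Fin 2) ℂ) hρ0 hρρ₀ (by rw [hρ2, hρsq])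
  rw [← hM] at hdist
  -- the residual-orbit distance of `U` to `U₀` is at most `(M·ρ)²`
  have hD : (⨅ w' : {w : Site (F.P K) 0 → Matrix.specialUnitaryGroup (Fin 2) ℂ |
        ∀ U : GaugeField (F.P K) 0 (Matrix.specialUnitaryGroup (Fin 2) ℂ),
          descendTo F ℰp J K hJK.le (GaugeField.gaugeAct w U) = descendTo F ℰp J K hJK.le U},
      ∑ ℓ : PBond (F.P K) 0,
        dist1 (U ℓ * ((GaugeField.gaugeAct (w' : Site (F.P K) 0 → Matrix.specialUnitaryGroup (Fin 2) ℂ) U₀) ℓ)⁻¹) ^ 2) ≤ (M * ρ) ^ 2 := by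
    rw [← iInf_orbitDistSq_gaugeAct_left F hJK.le hwres U U₀]
    refine (iInf_orbitDistSq_le_sum_one F hJK.le _ _).trans ?_
    obtain ⟨S, hS⟩ : ∃ S : ℝ, S = ∑ ℓ : PBond (F.P K) 0, dist1 ((GaugeField.gaugeAct w U) ℓ * (U₀ ℓ)⁻¹) ^ 2 := ⟨_, rfl⟩
    rw [← hS] at hdist ⊢
    have h0 : 0 ≤ S := by rw [hS]; exact Finset.sum_nonneg fun ℓ _ => sq_nonneg _
    calc S = Real.sqrt S ^ 2 := (Real.sq_sqrt h0).symm
      _ ≤ (M * ρ) ^ 2 := pow_le_pow_left₀ (Real.sqrt_nonneg _) hdist 2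
  -- conclusion
  rw [← hmin]
  calc cℓ / M ^ 2 * (⨅ w' : {w : Site (F.P K) 0 → Matrix.specialUnitaryGroup (Fin 2) ℂ |
          ∀ U : GaugeField (F.P K) 0 (Matrix.specialUnitaryGroup (Fin 2) ℂ),
            descendTo F ℰp J K hJK.le (GaugeField.gaugeAct w U) = descendTo F ℰp J K hJK.le U},
        ∑ ℓ : PBond (F.P K) 0,
          dist1 (U ℓ * ((GaugeField.gaugeAct (w' : Site (F.P K) 0 → Matrix.specialUnitaryGroup (Fin 2) ℂ) U₀) ℓ)⁻¹) ^ 2)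
      ≤ cℓ / M ^ 2 * (M * ρ) ^ 2 := mul_le_mul_of_nonneg_left hD (div_nonneg hcℓ0.le (by positivity))
    _ = cℓ * ρsq := by rw [mul_pow, hρ2]; field_simp
    _ ≤ wilsonAction4 U - wilsonAction4 U₀ := hgrow'


/-- ★★★ **THE SAME WITH `hcont` AND (Lπ)_loc DISCHARGED** (✓px17 g16 `growthOn_nhds_at_isCritR2_of_lift_five'`'s proof VERBATIM, keyed on `hOG` and `1 < L`).
[cite: Balaban1985Variational, (2)-(6) p.278, Thm 1 (8)-(10) p.279, (141)-(143) p.299; Balaban1985Averaging, Prop. 2 (52)-(54) p.26, Prop. 5 (157) p.42] -/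
theorem growthOn_nhds_at_isCritR2_of_lift_of_orbitGrowth' {L : ℕ} (hL : 1 < L)
    (hOG : ∃ e₈ c : ℝ, 0 < e₈ ∧ 0 < c ∧
        ∀ (F : T3Family), F.L = L → ∀ (n K : ℕ) (hnK : n < K) (e : ℝ) (V : GaugeField (F.P n) 0 (Matrix.specialUnitaryGroup (Fin 2) ℂ))
          (W : GaugeField (F.P K) 0 (Matrix.specialUnitaryGroup (Fin 2) ℂ)),
          0 < e → e ≤ e₈ → W ∈ regFibrePr F n K hnK.le e V → IsCritR2 F n K hnK.le V W →
          ∀ W' : GaugeField (F.P K) 0 (Matrix.specialUnitaryGroup (Fin 2) ℂ), W' ∈ regFibrePr F n K hnK.le e V →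
            ∃ u : GaugeTransf (F.P K) 0 (Matrix.specialUnitaryGroup (Fin 2) ℂ),
              c * (((F.L : ℝ) ^ (K - n)) ^ 2)⁻¹ * (∑ ℓ : PBond (F.P K) 0, dist1 (W' ℓ * ((GaugeField.gaugeAct u W) ℓ)⁻¹) ^ 2)
                ≤ wilsonAction4 W' - wilsonAction4 W) :
    ∃ e₉ : ℝ, 0 < e₉ ∧
      ∀ (F : T3Family), F.L = L → ∀ (J K : ℕ) (hJK : J < K) (γ b₀ p₀ ε₀ : ℝ)
        (V : GaugeField (F.P J) 0 (Matrix.specialUnitaryGroup (Fin 2) ℂ)) (U₀ : GaugeField (F.P K) 0 (Matrix.specialUnitaryGroup (Fin 2) ℂ)),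
        0 < ε₀ → ε₀ ≤ e₉ → U₀ ∈ regFibrePr F J K hJK.le ε₀ V → IsCritR2 F J K hJK.le V U₀ →
        wilsonAction4 U₀ = minActionRegPr F J K hJK.le ε₀ V →
        (∀ s : GaugeTransf (F.P J) 0 (Matrix.specialUnitaryGroup (Fin 2) ℂ), GaugeField.gaugeAct s V = V →
            ∃ k : GaugeTransf (F.P K) 0 (Matrix.specialUnitaryGroup (Fin 2) ℂ), GaugeField.gaugeAct k U₀ = U₀ ∧ descTransf F J K hJK.le k = s) →
        ∃ N ∈ 𝓝 U₀, ∃ c : ℝ, 0 < c ∧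
          ∀ U ∈ closure (fibre F ℰp J K hJK.le V ∩ histGood F ℰp (θBal F.L γ b₀ p₀) K J), U ∈ N →
            c * (⨅ w : {w : Site (F.P K) 0 → Matrix.specialUnitaryGroup (Fin 2) ℂ |
                  ∀ U : GaugeField (F.P K) 0 (Matrix.specialUnitaryGroup (Fin 2) ℂ),
                    descendTo F ℰp J K hJK.le (GaugeField.gaugeAct w U) = descendTo F ℰp J K hJK.le U},
                ∑ ℓ : PBond (F.P K) 0,
                  dist1 (U ℓ * ((GaugeField.gaugeAct (w : Site (F.P K) 0 → Matrix.specialUnitaryGroup (Fin 2) ℂ) U₀) ℓ)⁻¹) ^ 2)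
              ≤ wilsonAction4 U - minActionRegPr F J K hJK.le ε₀ V := by
  obtain ⟨e₈, he₈, H⟩ := growthOn_nhds_at_isCritR2_of_lift_of_orbitGrowth hOG
  obtain ⟨eπ, heπ, Hπ⟩ := exists_threshold_supLipschitz L hL.le
  obtain ⟨eπ', heπ', Hπ'⟩ := exists_ePi L hL.le
  refine ⟨min e₈ (min eπ (eπ' / 2)), lt_min he₈ (lt_min heπ (by positivity)), ?_⟩
  intro F hF J K hJK γ b₀ p₀ ε₀ V U₀ hε₀ hεe hU₀reg hcrit hmin hlift
  have hε8 : ε₀ ≤ e₈ := hεe.trans (min_le_left _ _)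
  have hεπ : ε₀ ≤ eπ := hεe.trans ((min_le_right _ _).trans (min_le_left _ _))
  have hεπ' : 2 * ε₀ ≤ eπ' := by have := hεe.trans ((min_le_right _ _).trans (min_le_right _ _)); linarith
  obtain ⟨hr3, hr2, -⟩ := Hπ' (2 * ε₀) (by positivity) hεπ'
  rw [← hF] at hr2
  obtain ⟨ρ₀, Kπ, hρ₀, hKπ, hLip⟩ := Hπ F hF J K hJK.le ε₀ hε₀ hεπ V U₀ hU₀reg
  exact H F hF J K hJK ε₀ γ b₀ p₀ ε₀ V U₀ hε₀ hε8 hU₀reg hcrit hmin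
    (eventually_continuousAt_descendTo_of_mem_regFibrePr F hJK.le hε₀ hr3 hr2 hU₀reg) hlift ρ₀ Kπ hρ₀ hKπ hLip


/-- ★★★ **POS∘ AT PRINT'S REGULAR MINIMISER OVER A DATUM WHOSE SYMMETRIES LIFT ⟸ `hlift`, EVERY TUBE RADIUS — keyed on `hOG` and `1 < L`** (✓px17 g16
`posCollar_at_isCritR2_of_lift_five'`'s text and proof). [cite: Balaban1985Variational, Thm 1 (8)-(10) p.279, (141)-(143) p.299; Balaban1985UV3, (12)-(13) p.259] -/
theorem posCollar_at_isCritR2_of_lift_of_orbitGrowth' {L : ℕ} (hL : 1 < L)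
    (hOG : ∃ e₈ c : ℝ, 0 < e₈ ∧ 0 < c ∧
        ∀ (F : T3Family), F.L = L → ∀ (n K : ℕ) (hnK : n < K) (e : ℝ) (V : GaugeField (F.P n) 0 (Matrix.specialUnitaryGroup (Fin 2) ℂ))
          (W : GaugeField (F.P K) 0 (Matrix.specialUnitaryGroup (Fin 2) ℂ)),
          0 < e → e ≤ e₈ → W ∈ regFibrePr F n K hnK.le e V → IsCritR2 F n K hnK.le V W →
          ∀ W' : GaugeField (F.P K) 0 (Matrix.specialUnitaryGroup (Fin 2) ℂ), W' ∈ regFibrePr F n K hnK.le e V →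
            ∃ u : GaugeTransf (F.P K) 0 (Matrix.specialUnitaryGroup (Fin 2) ℂ),
              c * (((F.L : ℝ) ^ (K - n)) ^ 2)⁻¹ * (∑ ℓ : PBond (F.P K) 0, dist1 (W' ℓ * ((GaugeField.gaugeAct u W) ℓ)⁻¹) ^ 2)
                ≤ wilsonAction4 W' - wilsonAction4 W) :
    ∃ e₉ : ℝ, 0 < e₉ ∧
      ∀ (F : T3Family), F.L = L → ∀ (J K : ℕ) (hJK : J < K) (γ b₀ p₀ ε₀ : ℝ)
        (V : GaugeField (F.P J) 0 (Matrix.specialUnitaryGroup (Fin 2) ℂ)) (U₀ : GaugeField (F.P K) 0 (Matrix.specialUnitaryGroup (Fin 2) ℂ)) (δ : ℝ),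
        0 < ε₀ → ε₀ ≤ e₉ → U₀ ∈ regFibrePr F J K hJK.le ε₀ V → IsCritR2 F J K hJK.le V U₀ →
        wilsonAction4 U₀ = minActionRegPr F J K hJK.le ε₀ V →
        (∀ s : GaugeTransf (F.P J) 0 (Matrix.specialUnitaryGroup (Fin 2) ℂ), GaugeField.gaugeAct s V = V →
            ∃ k : GaugeTransf (F.P K) 0 (Matrix.specialUnitaryGroup (Fin 2) ℂ), GaugeField.gaugeAct k U₀ = U₀ ∧ descTransf F J K hJK.le k = s) →
        ∃ r c : ℝ, 0 < r ∧ 0 < c ∧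
          ∀ U ∈ closure (fibre F ℰp J K hJK.le V ∩ histGood F ℰp (θBal F.L γ b₀ p₀) K J),
            (∃ w : Site (F.P K) 0 → Matrix.specialUnitaryGroup (Fin 2) ℂ,
              (∀ U'' : GaugeField (F.P K) 0 (Matrix.specialUnitaryGroup (Fin 2) ℂ),
                  descendTo F ℰp J K hJK.le (GaugeField.gaugeAct w U'') = descendTo F ℰp J K hJK.le U'') ∧
                ∀ ℓ : PBond (F.P K) 0, dist1 (U ℓ * ((GaugeField.gaugeAct w U₀) ℓ)⁻¹) ≤ δ) →
            (⨅ w : {w : Site (F.P K) 0 → Matrix.specialUnitaryGroup (Fin 2) ℂ |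
                  ∀ U : GaugeField (F.P K) 0 (Matrix.specialUnitaryGroup (Fin 2) ℂ),
                    descendTo F ℰp J K hJK.le (GaugeField.gaugeAct w U) = descendTo F ℰp J K hJK.le U},
                ∑ ℓ : PBond (F.P K) 0,
                  dist1 (U ℓ * ((GaugeField.gaugeAct (w : Site (F.P K) 0 → Matrix.specialUnitaryGroup (Fin 2) ℂ) U₀) ℓ)⁻¹) ^ 2) ≤ r →
            c * (⨅ w : {w : Site (F.P K) 0 → Matrix.specialUnitaryGroup (Fin 2) ℂ |
                  ∀ U : GaugeField (F.P K) 0 (Matrix.specialUnitaryGroup (Fin 2) ℂ),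
                    descendTo F ℰp J K hJK.le (GaugeField.gaugeAct w U) = descendTo F ℰp J K hJK.le U},
                ∑ ℓ : PBond (F.P K) 0,
                  dist1 (U ℓ * ((GaugeField.gaugeAct (w : Site (F.P K) 0 → Matrix.specialUnitaryGroup (Fin 2) ℂ) U₀) ℓ)⁻¹) ^ 2)
              ≤ wilsonAction4 U - minActionRegPr F J K hJK.le ε₀ V := by
  obtain ⟨e₉, he₉, H⟩ := growthOn_nhds_at_isCritR2_of_lift_of_orbitGrowth' hL hOG
  refine ⟨e₉, he₉, ?_⟩
  intro F hF J K hJK γ b₀ p₀ ε₀ V U₀ δ hε₀ hεe hU₀reg hcrit hmin hlift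
  obtain ⟨N, hN, c, hc, hgrowN⟩ := H F hF J K hJK γ b₀ p₀ ε₀ V U₀ hε₀ hεe hU₀reg hcrit hmin hlift
  exact posCollar_of_growthOn_nhds F hJK.le V U₀ δ hN hc hgrowN


/-! ## §3 ★★★ The `hPos` letter of ✓p811291 at every `L > 1` from the ONE named fact -/

/-- ★★★ **POS∘ AT PRINT'S REGULAR MINIMISER (under `hlift`, every radius) AT EVERY BLOCK SIZE `L > 1` FROM `B8Thm2AtT3Members`** — the `hPos`∕`hPos₃` letter of ✓p811291
`gapFlatOrganAt_of_letters` ∕ `gapFlatOrgan_of_lettersAtThree` (text = ✓`posCollar_at_isCritR2_of_lift_five'`'s conclusion at `L`): ✓`hThm2S_of_b8Thm2AtT3Members hX L hL` ∘ §1 ∘ §2.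
CONDITIONAL on the named fact (OPEN exactly at `L = 3`). [cite: Balaban1985RegularSpaces, Thm 2 p.83; Balaban1985Variational, (141)-(143) p.299] -/
theorem posCollar_at_isCritR2_of_lift_of_b8Thm2AtT3Members (hX : B8Thm2AtT3Members) (L : ℕ) (hL : 1 < L) :
    ∃ e₉ : ℝ, 0 < e₉ ∧
      ∀ (F : T3Family), F.L = L → ∀ (J K : ℕ) (hJK : J < K) (γ b₀ p₀ ε₀ : ℝ)
        (V : GaugeField (F.P J) 0 (Matrix.specialUnitaryGroup (Fin 2) ℂ)) (U₀ : GaugeField (F.P K) 0 (Matrix.specialUnitaryGroup (Fin 2) ℂ)) (δ : ℝ),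
        0 < ε₀ → ε₀ ≤ e₉ → U₀ ∈ regFibrePr F J K hJK.le ε₀ V → IsCritR2 F J K hJK.le V U₀ →
        wilsonAction4 U₀ = minActionRegPr F J K hJK.le ε₀ V →
        (∀ s : GaugeTransf (F.P J) 0 (Matrix.specialUnitaryGroup (Fin 2) ℂ), GaugeField.gaugeAct s V = V →
            ∃ k : GaugeTransf (F.P K) 0 (Matrix.specialUnitaryGroup (Fin 2) ℂ), GaugeField.gaugeAct k U₀ = U₀ ∧ descTransf F J K hJK.le k = s) →
        ∃ r c : ℝ, 0 < r ∧ 0 < c ∧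
          ∀ U ∈ closure (fibre F ℰp J K hJK.le V ∩ histGood F ℰp (θBal F.L γ b₀ p₀) K J),
            (∃ w : Site (F.P K) 0 → Matrix.specialUnitaryGroup (Fin 2) ℂ,
              (∀ U'' : GaugeField (F.P K) 0 (Matrix.specialUnitaryGroup (Fin 2) ℂ),
                  descendTo F ℰp J K hJK.le (GaugeField.gaugeAct w U'') = descendTo F ℰp J K hJK.le U'') ∧
                ∀ ℓ : PBond (F.P K) 0, dist1 (U ℓ * ((GaugeField.gaugeAct w U₀) ℓ)⁻¹) ≤ δ) →
            (⨅ w : {w : Site (F.P K) 0 → Matrix.specialUnitaryGroup (Fin 2) ℂ |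
                  ∀ U : GaugeField (F.P K) 0 (Matrix.specialUnitaryGroup (Fin 2) ℂ),
                    descendTo F ℰp J K hJK.le (GaugeField.gaugeAct w U) = descendTo F ℰp J K hJK.le U},
                ∑ ℓ : PBond (F.P K) 0,
                  dist1 (U ℓ * ((GaugeField.gaugeAct (w : Site (F.P K) 0 → Matrix.specialUnitaryGroup (Fin 2) ℂ) U₀) ℓ)⁻¹) ^ 2) ≤ r →
            c * (⨅ w : {w : Site (F.P K) 0 → Matrix.specialUnitaryGroup (Fin 2) ℂ |
                  ∀ U : GaugeField (F.P K) 0 (Matrix.specialUnitaryGroup (Fin 2) ℂ),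
                    descendTo F ℰp J K hJK.le (GaugeField.gaugeAct w U) = descendTo F ℰp J K hJK.le U},
                ∑ ℓ : PBond (F.P K) 0,
                  dist1 (U ℓ * ((GaugeField.gaugeAct (w : Site (F.P K) 0 → Matrix.specialUnitaryGroup (Fin 2) ℂ) U₀) ℓ)⁻¹) ^ 2)
              ≤ wilsonAction4 U - minActionRegPr F J K hJK.le ε₀ V := by
  obtain ⟨B₁, c₁, hB₁, hc₁, hT⟩ := hThm2S_of_b8Thm2AtT3Members hX L hL
  exact posCollar_at_isCritR2_of_lift_of_orbitGrowth' hL (orbitGrowth_of_isCritR2_of_thm2S hL hB₁ hc₁ hT)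


end Summit.QuantumFields.YangMills.Theorems.FluctuationComparisonRegPrIntLS2BetaPosCollarOfB8Thm2AtT3Members

end
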